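import Literature.Analysis.Complex.RademacherPhragmenLindelof
import Literature.NumberTheory.LFunctions.CertifiedDirichletLTuringMethodProofs
import Literature.NumberTheory.LFunctions.DedekindZetaFiniteOrderProofs
import HarnessLib

/-!
# Rademacher's uniform convexity bound for Dirichlet `L`-functions (Rademacher 1959, §§5–6)

H. Rademacher, *On the Phragmén–Lindelöf theorem and some applications*, Math. Z. **72**
(1959) 192–204, §5 (the three `Γ`-quotient lemmas) and §6 (Theorem 3), **proved** — every
statement of this file is a theorem; no new named fact is introduced.  The Phragmén–Lindelöf
theorem of the paper (its Theorem 2) is the tree's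
`Literature.Analysis.Complex.Rademacher.norm_le_interpolate`
(`Literature/Analysis/Complex/RademacherPhragmenLindelof.lean`); the present file formalizes the
*applications* of §§5–6 exactly along the printed proofs.

* `Rademacher1959.norm_Gamma_quot_le` — **Lemma 1, (5.1):** for `Q ≥ 0`, `−½ ≤ σ ≤ ½`,
  `|Γ(Q/2 + (1−s)/2) / Γ(Q/2 + s/2)| ≤ (½|Q + 1 + s|)^{½−σ}`.
* `Rademacher1959.norm_Gamma_quot_le_sharp` — **Lemma 2, (5.3):** for `Q ≥ ½`, `−½ ≤ σ ≤ ½`,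
  `|Γ(Q/2 + (1−s)/2) / Γ(Q/2 + s/2)| ≤ (½|Q + s|)^{½−σ}` (for `Q = ½` "by a passage to the limit",
  as printed).
* `Rademacher1959.norm_Gamma_quot_le'` — **Lemma 3, (5.4):** for `Q ≥ 0`, `−½ ≤ σ ≤ ½`,
  `|Γ(Q + 1 − s) / Γ(Q + s)| ≤ |Q + 1 + s|^{1−2σ}`.
* `Rademacher1959.norm_LFunction_eq_reflect` — the display of §6: for a primitive `χ` mod `k > 1`
  with `χ(−1) = (−1)^a`, `|L(s, χ)| = (π/k)^{σ−½} |Γ(a/2 + (1−s)/2)/Γ(a/2 + s/2)| |L(1−s, χ̄)|`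
  (here for `σ < 1`, where both sides are finite; `a = charParity χ`).
* `Rademacher1959.norm_LFunction_le_reflect` — §6: for `−½ ≤ σ ≤ ½`,
  `|L(s, χ)| ≤ (2π/k)^{σ−½} |1 + s|^{½−σ} |L(1−s, χ̄)|`.
* `Rademacher1959.norm_LFunction_le_of_re_eq_neg` — **(6.2):** for `0 < η ≤ ½`,
  `|L(−η + it, χ)| ≤ (k/2π)^{η+½} |1 + s|^{η+½} ζ(1 + η)`.
* `Rademacher1959.norm_LFunction_le` — **Theorem 3 (p. 199):** for `0 < η ≤ ½`,
  `−η ≤ σ ≤ 1 + η`, all moduli `k > 1` and all primitive `χ` mod `k`,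
  `|L(s, χ)| ≤ (k|1 + s|/2π)^{(1+η−σ)/2} ζ(1 + η)`.

This is the uniform (in `k` and `t` "in the same order of magnitude") upper bound quoted as
Lemma 4 of [Rumely 1993, p. 430] ("See [19, Theorem 3, p. 199]") and as (3.5)–(3.6) of
[Trudgian 2011, §3]: the upper-bound input of every explicit estimate of `∫ S(t, χ) dt` in Turing's
method for Dirichlet `L`-functions (`rumely1993_theorem2`, `trudgian2011_theorem38`).

Conventions.  `L(s, χ) = DirichletCharacter.LFunction χ s` (Mathlib), `χ̄ = χ⁻¹`,
`ζ(1 + η) = (riemannZeta (1 + η)).re = Booker2006Turing.bigZ (1 + η)` (real and `≥ 1` for `η > 0`,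
`Booker2006Turing.bigZ_eq_norm`).  In the `Γ`-quotient lemmas Mathlib's junk value `Γ(−n) = 0`
makes the quotient `0` at the (removable) poles of the denominator, where the printed bound holds
trivially; everywhere else the quotient is the printed one.

Proof architecture (as printed).  Lemmas 1–3: Theorem 2 (`norm_le_interpolate`) on the strip
`S(−½, ½)` for `f(s) = Γ(Q/2 + (1−s)/2)/Γ(Q/2 + s/2)` (resp. `Γ(Q+1−s)/Γ(Q+s)`): on `σ = −½`,
by `|Γ(s̄)| = |Γ(s)|` and `Γ(w + 1) = wΓ(w)`, `|f| = ½|Q − ½ + it| ≤ ½|Q + 1 + a + it|`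
(resp. `= ½|Q + a + it|`, resp. `|Q + ½ + it||Q − ½ + it| ≤ |Q + 1 + a + it|²`); on `σ = ½`,
`|f| = 1`; `α = 1` (resp. `2`), `β = 0`, "with `Q + 1` instead of `Q`" (resp. `Q`).  The a-priori
finite-order growth of `f` in the strip ("regular in the strip", of finite order by Stirling) is
supplied by `‖Γ(u)‖ ≤ Γ(Re u)` and the tree's `1/Γ` bound on vertical strips
(`NumberField.exists_norm_inv_Gamma_le_of_abs_re_le`).  Theorem 3: (6.1) `|L(1+η+it)| ≤ ζ(1+η)`
(`Booker2006Turing.norm_LFunction_le_bigZ`); the functional equation in the form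
`|L(s,χ)| = (π/k)^{σ−½}|Γ((a+1−s)/2)/Γ((a+s)/2)||L(1−s,χ̄)|` (Mathlib's
`IsPrimitive.completedLFunction_one_sub`, `|ε(χ)| = 1` = `SelbergDirichlet.norm_rootNumber`);
Lemma 1 (`a = 0`) or Lemma 2 (`a = 1`) give (6.2); Theorem 2 on `S(−η, 1+η)` with `Q = 1`,
`A = (k/2π)^{½+η} ζ(1+η)`, `α = ½ + η`, `B = ζ(1+η)`, `β = 0` (the finite order of `L(s, χ)` is
`SelbergDirichlet.norm_LFunction_le_exp`).

## References
* H. Rademacher, On the Phragmén–Lindelöf theorem and some applications, Math. Z. 72 (1959)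
  192–204, §5 Lemmas 1–3, §6 Theorem 3. [Rademacher1959]
* R. Rumely, Numerical computations concerning the ERH, Math. Comp. 61 (1993) 415–440, Lemma 4
  p. 430. [Rumely1993ERH]
-/

open Complex Set Filter Topology DirichletCharacter
open scoped Real ComplexConjugate

namespace Literature.NumberTheory.LFunctions

namespace Rademacher1959

/-! ### Elementary helpers -/

/-- `|z|² = (Re z)² + (Im z)²`. [folklore] -/
private lemma norm_sq_eq (z : ℂ) : ‖z‖ ^ 2 = z.re ^ 2 + z.im ^ 2 := by
  rw [Complex.sq_norm, Complex.normSq_apply]; ring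

/-- Comparison of norms through `(Re)² + (Im)²`. [folklore] -/
private lemma norm_le_norm_of_sq_le {w w' : ℂ}
    (h : w.re ^ 2 + w.im ^ 2 ≤ w'.re ^ 2 + w'.im ^ 2) : ‖w‖ ≤ ‖w'‖ := by
  rw [← norm_sq_eq, ← norm_sq_eq] at h
  exact (pow_le_pow_iff_left₀ (norm_nonneg w) (norm_nonneg w') two_ne_zero).mp h

/-- `t² ≤ 4 e^{|t|}` (from `1 + x ≤ eˣ` at `x = |t|/2`). [folklore] -/
private lemma sq_le_four_mul_exp_abs (t : ℝ) : t ^ 2 ≤ 4 * Real.exp |t| := by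
  have h1 : |t| / 2 + 1 ≤ Real.exp (|t| / 2) := Real.add_one_le_exp _
  have h2 : 0 ≤ |t| / 2 := by positivity
  have h3 : (|t| / 2) ^ 2 ≤ Real.exp (|t| / 2) ^ 2 := pow_le_pow_left₀ h2 (by linarith) 2
  have h4 : Real.exp (|t| / 2) ^ 2 = Real.exp |t| := by rw [sq, ← Real.exp_add]; ring_nf
  have h5 : t ^ 2 = 4 * (|t| / 2) ^ 2 := by rw [div_pow, ← sq_abs t]; ring
  rw [h5, ← h4]
  linarith

/-- `Real.Gamma` is bounded on compact subintervals of `(0, ∞)`. [folklore] -/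
private lemma exists_Gamma_le {lo hi : ℝ} (hlo : 0 < lo) :
    ∃ M : ℝ, 0 ≤ M ∧ ∀ x ∈ Icc lo hi, Real.Gamma x ≤ M := by
  have hcont : ContinuousOn Real.Gamma (Icc lo hi) := fun x hx ↦
    (Real.differentiableAt_Gamma fun m hm ↦ by
      have h0 : (0 : ℝ) < x := hlo.trans_le hx.1
      rw [hm] at h0
      have : (0 : ℝ) ≤ m := Nat.cast_nonneg m
      linarith).continuousAt.continuousWithinAt
  obtain ⟨M, hM⟩ := isCompact_Icc.exists_bound_of_continuousOn hcont
  refine ⟨max M 0, le_max_right _ _, fun x hx ↦ ?_⟩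
  have := hM x hx
  rw [Real.norm_eq_abs] at this
  exact ((le_abs_self _).trans this).trans (le_max_left _ _)

/-- `Γ w ≠ 0` unless `w = 0`, when `Re w > -1`. [folklore] -/
private lemma Gamma_ne_zero_of_neg_one_lt_re {w : ℂ} (hw : -1 < w.re) (hw0 : w ≠ 0) :
    Gamma w ≠ 0 := by
  refine Complex.Gamma_ne_zero fun m hm ↦ ?_
  have hre := congrArg re hm
  rw [neg_re, natCast_re] at hre
  have hm1 : (m : ℝ) < 1 := by linarith
  have hm0 : m = 0 := by exact_mod_cast (show m < 1 by exact_mod_cast hm1) |> Nat.lt_one_iff.mp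
  rw [hm0, Nat.cast_zero, neg_zero] at hm
  exact hw0 hm

/-! ### `Γ`-identities on the edges of the strip (`|Γ(s̄)| = |Γ(s)|`, `Γ(w+1) = wΓ(w)`) -/

/-- `|Γ(w̄ + 1)/Γ(w)| = |w|` for `Re w > −1` (`Γ(w̄+1) = w̄ Γ(w̄)`, `|Γ(w̄)| = |Γ(w)|`; at `w = 0`
both sides vanish with Mathlib's `Γ(0) = 0`). [folklore] -/
private lemma norm_Gamma_conj_add_one_div {w : ℂ} (hw : -1 < w.re) :
    ‖Gamma (conj w + 1) / Gamma w‖ = ‖w‖ := by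
  by_cases hw0 : w = 0
  · rw [hw0, map_zero, zero_add, Complex.Gamma_one, Complex.Gamma_zero, div_zero, norm_zero]
  have hΓ : Gamma w ≠ 0 := Gamma_ne_zero_of_neg_one_lt_re hw hw0
  have hcw : conj w ≠ 0 := (map_ne_zero _).mpr hw0
  rw [Complex.Gamma_add_one _ hcw, Complex.Gamma_conj, norm_div, norm_mul, Complex.norm_conj,
    Complex.norm_conj, mul_div_assoc, div_self (norm_ne_zero_iff.mpr hΓ), mul_one]

/-- `|Γ(w̄ + 2)/Γ(w)| = |w + 1| |w|` for `Re w > −1`. [folklore] -/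
private lemma norm_Gamma_conj_add_two_div {w : ℂ} (hw : -1 < w.re) :
    ‖Gamma (conj w + 1 + 1) / Gamma w‖ = ‖w + 1‖ * ‖w‖ := by
  have h1 : conj w + 1 = conj (w + 1) := by rw [map_add, map_one]
  have hw1re : 0 < (w + 1).re := by rw [add_re, one_re]; linarith
  have hw1 : conj w + 1 ≠ 0 := by
    rw [h1]
    exact (map_ne_zero _).mpr fun h0 ↦ by rw [h0, zero_re] at hw1re; exact lt_irrefl _ hw1re
  rw [Complex.Gamma_add_one _ hw1, mul_div_assoc, norm_mul, norm_Gamma_conj_add_one_div hw, h1,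
    Complex.norm_conj]

/-- `|Γ(w̄)/Γ(w)| = 1` for `Re w > 0`. [folklore] -/
private lemma norm_Gamma_conj_div {w : ℂ} (hw : 0 < w.re) : ‖Gamma (conj w) / Gamma w‖ = 1 := by
  rw [Complex.Gamma_conj, norm_div, Complex.norm_conj,
    div_self (norm_ne_zero_iff.mpr (Complex.Gamma_ne_zero_of_re_pos hw))]

/-! ### The `Γ`-quotient `f(s) = Γ(Q/2 + (1−s)/2) / Γ(Q/2 + s/2)` of Lemmas 1 and 2 -/

/-- On `σ = −½`: `|f(−½ + it)| = ½|Q − ½ + it|` (`|Γ(s̄)| = |Γ(s)|`, `Γ(w+1) = wΓ(w)`). [folklore] -/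
private lemma norm_quot_left {Q : ℝ} (hQ : 0 ≤ Q) {z : ℂ} (hz : z.re = -1 / 2) :
    ‖Gamma ((Q + 1 - z) / 2) / Gamma ((Q + z) / 2)‖ = ‖(Q : ℂ) + z‖ / 2 := by
  have hnum : ((Q : ℂ) + 1 - z) / 2 = conj (((Q : ℂ) + z) / 2) + 1 := by
    apply Complex.ext
    · simp only [div_ofNat_re, sub_re, add_re, ofReal_re, one_re, hz, conj_re]
      ring
    · simp only [div_ofNat_im, sub_im, add_im, ofReal_im, one_im, conj_im]
      ring
  have hre : -1 < (((Q : ℂ) + z) / 2).re := by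
    simp only [div_ofNat_re, add_re, ofReal_re, hz]
    linarith
  rw [hnum, norm_Gamma_conj_add_one_div hre, norm_div, Complex.norm_two]

/-- On `σ = ½`: `|f(½ + it)| = 1`. [folklore] -/
private lemma norm_quot_right {Q : ℝ} (hQ : 0 ≤ Q) {z : ℂ} (hz : z.re = 1 / 2) :
    ‖Gamma ((Q + 1 - z) / 2) / Gamma ((Q + z) / 2)‖ = 1 := by
  have hnum : ((Q : ℂ) + 1 - z) / 2 = conj (((Q : ℂ) + z) / 2) := by
    apply Complex.ext
    · simp only [div_ofNat_re, sub_re, add_re, ofReal_re, one_re, hz, conj_re]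
      ring
    · simp only [div_ofNat_im, sub_im, add_im, ofReal_im, one_im, conj_im]
      ring
  have hre : 0 < (((Q : ℂ) + z) / 2).re := by
    simp only [div_ofNat_re, add_re, ofReal_re, hz]
    linarith
  rw [hnum, norm_Gamma_conj_div hre]

/-- `f` is regular in a neighbourhood of the closed strip `−½ ≤ σ ≤ ½` (`1/Γ` is entire and the
numerator has its poles at `s = Q + 1 + 2n`). [folklore] -/
private lemma differentiableAt_quot {Q : ℝ} {z : ℂ} (hz : z.re < Q + 1) :
    DifferentiableAt ℂ (fun z : ℂ ↦ Gamma ((Q + 1 - z) / 2) / Gamma ((Q + z) / 2)) z := by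
  have hfun : (fun z : ℂ ↦ Gamma ((Q + 1 - z) / 2) / Gamma ((Q + z) / 2)) =
      fun z : ℂ ↦ Gamma ((Q + 1 - z) / 2) * (Gamma ((Q + z) / 2))⁻¹ :=
    funext fun z ↦ div_eq_mul_inv _ _
  rw [hfun]
  refine DifferentiableAt.mul ?_ ?_
  · refine (Complex.differentiableAt_Gamma _ fun m hm ↦ ?_).comp z
      (((differentiableAt_const _).sub differentiableAt_id).div_const 2)
    have hre := congrArg re hm
    simp only [div_ofNat_re, sub_re, add_re, ofReal_re, one_re, neg_re, natCast_re] at hre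
    have : (0 : ℝ) ≤ m := Nat.cast_nonneg m
    linarith
  · exact Complex.differentiable_one_div_Gamma.differentiableAt.comp z
      (((differentiableAt_const _).add differentiableAt_id).div_const 2)

/-- `f` is regular on the closed strip `−½ ≤ σ ≤ ½`. [folklore] -/
private lemma diffContOnCl_quot {Q : ℝ} (hQ : 0 ≤ Q) :
    DiffContOnCl ℂ (fun z : ℂ ↦ Gamma ((Q + 1 - z) / 2) / Gamma ((Q + z) / 2))
      (re ⁻¹' Ioo (-1 / 2 : ℝ) (1 / 2)) := by
  refine DifferentiableOn.diffContOnCl fun z hz ↦ ?_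
  rw [closure_preimage_re, closure_Ioo (by norm_num), mem_preimage, mem_Icc] at hz
  exact (differentiableAt_quot (by linarith [hz.2])).differentiableWithinAt

/-- `f` is of finite order in the open strip (crudely: `|f| ≤ K exp(L e^{|t|})`). [folklore] -/
private lemma growth_quot {Q : ℝ} (hQ : 0 ≤ Q) :
    ∃ c < π / ((1 / 2 : ℝ) - -1 / 2), ∃ K L : ℝ, ∀ z : ℂ, -1 / 2 < z.re → z.re < 1 / 2 →
      ‖(fun z : ℂ ↦ Gamma ((Q + 1 - z) / 2) / Gamma ((Q + z) / 2)) z‖ ≤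
        K * Real.exp (L * Real.exp (c * |z.im|)) := by
  obtain ⟨M, hM0, hM⟩ := exists_Gamma_le (lo := (Q + 1 / 2) / 2) (hi := (Q + 3 / 2) / 2)
    (by linarith)
  obtain ⟨A, c, hA, hc, hAc⟩ :=
    NumberField.exists_norm_inv_Gamma_le_of_abs_re_le (S := (Q + 1 / 2) / 2) (by linarith)
  refine ⟨1, ?_, M * (A * Real.exp (c * ((Q + 1 / 2) / 2) ^ 2)), c, fun z h1 h2 ↦ ?_⟩
  · have : π / ((1 / 2 : ℝ) - -1 / 2) = π := by norm_num
    rw [this]; linarith [Real.pi_gt_three]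
  simp only [one_mul]
  rw [norm_div, div_eq_mul_inv, ← norm_inv]
  have hre1 : (((Q : ℂ) + 1 - z) / 2).re = (Q + 1 - z.re) / 2 := by
    simp only [div_ofNat_re, sub_re, add_re, ofReal_re, one_re]
  have hre2 : (((Q : ℂ) + z) / 2).re = (Q + z.re) / 2 := by
    simp only [div_ofNat_re, add_re, ofReal_re]
  have him2 : (((Q : ℂ) + z) / 2).im = z.im / 2 := by
    simp only [div_ofNat_im, add_im, ofReal_im, zero_add]
  have hnum : ‖Gamma (((Q : ℂ) + 1 - z) / 2)‖ ≤ M := by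
    refine (norm_Gamma_le_Gamma_re (by rw [hre1]; linarith)).trans (hM _ ⟨?_, ?_⟩)
    · rw [hre1]; linarith
    · rw [hre1]; linarith
  have hden : ‖(Gamma (((Q : ℂ) + z) / 2))⁻¹‖ ≤
      A * Real.exp (c * ((Q + 1 / 2) / 2) ^ 2) * Real.exp (c * Real.exp |z.im|) := by
    have hre : |(((Q : ℂ) + z) / 2).re| ≤ (Q + 1 / 2) / 2 := by
      rw [hre2, abs_le]; constructor <;> linarith
    refine (hAc _ hre).trans ?_
    rw [mul_assoc, ← Real.exp_add]
    gcongr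
    have hsq : ‖((Q : ℂ) + z) / 2‖ ^ 2 ≤ ((Q + 1 / 2) / 2) ^ 2 + Real.exp |z.im| := by
      rw [norm_sq_eq, hre2, him2]
      have ha' : ((Q + z.re) / 2) ^ 2 ≤ ((Q + 1 / 2) / 2) ^ 2 :=
        sq_le_sq' (by linarith) (by linarith)
      have hb' : (z.im / 2) ^ 2 ≤ Real.exp |z.im| := by
        have := sq_le_four_mul_exp_abs z.im
        rw [div_pow]; linarith
      linarith
    calc c * ‖((Q : ℂ) + z) / 2‖ ^ 2 ≤ c * (((Q + 1 / 2) / 2) ^ 2 + Real.exp |z.im|) := by gcongr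
      _ = c * ((Q + 1 / 2) / 2) ^ 2 + c * Real.exp |z.im| := by ring
  calc ‖Gamma (((Q : ℂ) + 1 - z) / 2)‖ * ‖(Gamma (((Q : ℂ) + z) / 2))⁻¹‖
      ≤ M * (A * Real.exp (c * ((Q + 1 / 2) / 2) ^ 2) * Real.exp (c * Real.exp |z.im|)) :=
        mul_le_mul hnum hden (norm_nonneg _) hM0
    _ = M * (A * Real.exp (c * ((Q + 1 / 2) / 2) ^ 2)) * Real.exp (c * Real.exp |z.im|) := by
        ring

/-- **Rademacher 1959, Lemma 1, (5.1):** "For `Q ≥ 0`, `−½ ≤ σ ≤ ½` we have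
`|Γ(Q/2 + (1−s)/2) / Γ(Q/2 + s/2)| ≤ (½|Q + 1 + s|)^{½−σ}`.  Remark. Equality holds here for
`σ = ½`, any `Q ≥ 0`, and for `σ = −½` with `Q = 0`."  Proof as printed: Theorem 2
(`Rademacher.norm_le_interpolate`) for `f(s) = Γ(Q/2 + (1−s)/2)/Γ(Q/2 + s/2)` on `S(−½, ½)` with
`|f(a+it)| = ½|Q − ½ + it| ≤ ½|Q + 1 + a + it|`, `|f(b+it)| = 1`, `α = 1`, `β = 0`, and `Q + 1`
instead of `Q`. [cite: Rademacher1959, §5 Lemma 1 (5.1)] -/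
theorem norm_Gamma_quot_le {Q : ℝ} (hQ : 0 ≤ Q) {s : ℂ} (h₁ : -1 / 2 ≤ s.re)
    (h₂ : s.re ≤ 1 / 2) :
    ‖Gamma (Q / 2 + (1 - s) / 2) / Gamma (Q / 2 + s / 2)‖ ≤
      (‖(Q : ℂ) + 1 + s‖ / 2) ^ (1 / 2 - s.re) := by
  have e1 : (Q : ℂ) / 2 + (1 - s) / 2 = (Q + 1 - s) / 2 := by ring
  have e2 : (Q : ℂ) / 2 + s / 2 = (Q + s) / 2 := by ring
  rw [e1, e2]
  have ha : ∀ z : ℂ, z.re = -1 / 2 →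
      ‖(fun z : ℂ ↦ Gamma ((Q + 1 - z) / 2) / Gamma ((Q + z) / 2)) z‖ ≤
        1 / 2 * ‖((Q + 1 : ℝ) : ℂ) + z‖ ^ (1 : ℝ) := by
    intro z hz
    simp only
    rw [Real.rpow_one, norm_quot_left hQ hz]
    have : ‖(Q : ℂ) + z‖ ≤ ‖((Q + 1 : ℝ) : ℂ) + z‖ := by
      apply norm_le_norm_of_sq_le
      simp only [add_re, ofReal_re, hz, add_im, ofReal_im, zero_add]
      nlinarith
    linarith
  have hb : ∀ z : ℂ, z.re = 1 / 2 →
      ‖(fun z : ℂ ↦ Gamma ((Q + 1 - z) / 2) / Gamma ((Q + z) / 2)) z‖ ≤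
        1 * ‖((Q + 1 : ℝ) : ℂ) + z‖ ^ (0 : ℝ) := by
    intro z hz
    simp only
    rw [Real.rpow_zero, mul_one, norm_quot_right hQ hz]
  have key := Literature.Analysis.Complex.Rademacher.norm_le_interpolate
    (f := fun z : ℂ ↦ Gamma ((Q + 1 - z) / 2) / Gamma ((Q + z) / 2))
    (show (-1 / 2 : ℝ) < 1 / 2 by norm_num) (show (0 : ℝ) < Q + 1 + -1 / 2 by linarith)
    (show (0 : ℝ) < 1 / 2 by norm_num) one_pos zero_le_one (diffContOnCl_quot hQ)
    (growth_quot hQ) ha hb h₁ h₂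
  simp only [Real.rpow_zero, mul_one, Real.one_rpow, Real.rpow_one] at key
  have e3 : ((Q + 1 : ℝ) : ℂ) + s = (Q : ℂ) + 1 + s := by push_cast; ring
  rw [e3] at key
  convert key using 2
  · ring
  · norm_num

/-- Lemma 2 for `Q > ½` (Theorem 2 applies with `Q + a = Q − ½ > 0`). [folklore] -/
private lemma norm_Gamma_quot_le_sharp_of_lt {Q : ℝ} (hQ : 1 / 2 < Q) {s : ℂ}
    (h₁ : -1 / 2 ≤ s.re) (h₂ : s.re ≤ 1 / 2) :
    ‖Gamma ((Q + 1 - s) / 2) / Gamma ((Q + s) / 2)‖ ≤ (‖(Q : ℂ) + s‖ / 2) ^ (1 / 2 - s.re) := by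
  have hQ0 : 0 ≤ Q := by linarith
  have ha : ∀ z : ℂ, z.re = -1 / 2 →
      ‖(fun z : ℂ ↦ Gamma ((Q + 1 - z) / 2) / Gamma ((Q + z) / 2)) z‖ ≤
        1 / 2 * ‖(Q : ℂ) + z‖ ^ (1 : ℝ) := by
    intro z hz
    simp only
    rw [Real.rpow_one, norm_quot_left hQ0 hz]
    linarith
  have hb : ∀ z : ℂ, z.re = 1 / 2 →
      ‖(fun z : ℂ ↦ Gamma ((Q + 1 - z) / 2) / Gamma ((Q + z) / 2)) z‖ ≤
        1 * ‖(Q : ℂ) + z‖ ^ (0 : ℝ) := by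
    intro z hz
    simp only
    rw [Real.rpow_zero, mul_one, norm_quot_right hQ0 hz]
  have key := Literature.Analysis.Complex.Rademacher.norm_le_interpolate
    (f := fun z : ℂ ↦ Gamma ((Q + 1 - z) / 2) / Gamma ((Q + z) / 2))
    (show (-1 / 2 : ℝ) < 1 / 2 by norm_num) (show (0 : ℝ) < Q + -1 / 2 by linarith)
    (show (0 : ℝ) < 1 / 2 by norm_num) one_pos zero_le_one (diffContOnCl_quot hQ0)
    (growth_quot hQ0) ha hb h₁ h₂
  simp only [Real.rpow_zero, mul_one, Real.one_rpow, Real.rpow_one] at key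
  convert key using 2
  · ring
  · norm_num

/-- **Rademacher 1959, Lemma 2, (5.3):** "For `Q − ½ ≥ 0`, `−½ ≤ σ ≤ ½` the inequality
`|Γ(Q/2 + (1−s)/2) / Γ(Q/2 + s/2)| ≤ (½|Q + s|)^{½−σ}` holds.  Remark. Equality in (5.3) on both
boundaries of `S(−½, ½)` for all `Q ≥ ½`."  Proof as printed: as Lemma 1 but with
`|f(a+it)| = ½|Q − ½ − it| = ½|Q + a + it|`, "which again permits the application of Theorem 2
for `Q + a = Q − ½ > 0`.  For `Q − ½ = 0` formula (5.3) follows by a passage to the limit."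
[cite: Rademacher1959, §5 Lemma 2 (5.3)] -/
theorem norm_Gamma_quot_le_sharp {Q : ℝ} (hQ : 1 / 2 ≤ Q) {s : ℂ} (h₁ : -1 / 2 ≤ s.re)
    (h₂ : s.re ≤ 1 / 2) :
    ‖Gamma (Q / 2 + (1 - s) / 2) / Gamma (Q / 2 + s / 2)‖ ≤
      (‖(Q : ℂ) + s‖ / 2) ^ (1 / 2 - s.re) := by
  have e1 : (Q : ℂ) / 2 + (1 - s) / 2 = (Q + 1 - s) / 2 := by ring
  have e2 : (Q : ℂ) / 2 + s / 2 = (Q + s) / 2 := by ring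
  rw [e1, e2]
  rcases hQ.lt_or_eq with hlt | heq
  · exact norm_Gamma_quot_le_sharp_of_lt hlt h₁ h₂
  -- `Q = ½`: passage to the limit `Q → ½⁺`
  subst heq
  set g : ℝ → ℝ := fun Q ↦ ‖Gamma (((Q : ℂ) + 1 - s) / 2)‖ * ‖(Gamma (((Q : ℂ) + s) / 2))⁻¹‖
    with hg
  set h : ℝ → ℝ := fun Q ↦ (‖(Q : ℂ) + s‖ / 2) ^ (1 / 2 - s.re) with hh
  have hgf : ∀ Q : ℝ, ‖Gamma (((Q : ℂ) + 1 - s) / 2) / Gamma (((Q : ℂ) + s) / 2)‖ = g Q := by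
    intro Q
    simp only [hg, div_eq_mul_inv, norm_mul, norm_inv]
  rw [hgf]
  change g (1 / 2) ≤ h (1 / 2)
  have hgc : ContinuousAt g (1 / 2) := by
    refine ContinuousAt.mul ?_ ?_
    · refine (continuous_norm.continuousAt).comp ?_
      refine (Complex.differentiableAt_Gamma _ fun m hm ↦ ?_).continuousAt.comp ?_
      · have hre := congrArg re hm
        simp only [div_ofNat_re, sub_re, add_re, ofReal_re, one_re, neg_re, natCast_re] at hre
        have : (0 : ℝ) ≤ m := Nat.cast_nonneg m
        linarith
      · exact (((Complex.continuous_ofReal.add continuous_const).sub continuous_const).div_const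
          _).continuousAt
    · refine (continuous_norm.continuousAt).comp ?_
      exact Complex.differentiable_one_div_Gamma.continuous.continuousAt.comp
        (((Complex.continuous_ofReal.add continuous_const).div_const _).continuousAt)
  have hhc : ContinuousAt h (1 / 2) := by
    refine ContinuousAt.rpow_const ?_ (Or.inr (by linarith))
    exact (((continuous_norm.comp (Complex.continuous_ofReal.add continuous_const)).div_const
      _).continuousAt)
  have hev : ∀ᶠ Q in 𝓝[>] (1 / 2 : ℝ), g Q ≤ h Q := by
    refine eventually_nhdsWithin_of_forall fun Q hQ ↦ ?_
    rw [← hgf]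
    exact norm_Gamma_quot_le_sharp_of_lt hQ h₁ h₂
  exact le_of_tendsto_of_tendsto (hgc.tendsto.mono_left nhdsWithin_le_nhds)
    (hhc.tendsto.mono_left nhdsWithin_le_nhds) hev

/-! ### The `Γ`-quotient `f(s) = Γ(Q + 1 − s) / Γ(Q + s)` of Lemma 3 -/

/-- On `σ = −½`: `|f(−½ + it)| = |Q + ½ + it| |Q − ½ + it|`. [folklore] -/
private lemma norm_quot'_left {Q : ℝ} (hQ : 0 ≤ Q) {z : ℂ} (hz : z.re = -1 / 2) :
    ‖Gamma (Q + 1 - z) / Gamma (Q + z)‖ = ‖(Q : ℂ) + z + 1‖ * ‖(Q : ℂ) + z‖ := by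
  have hnum : (Q : ℂ) + 1 - z = conj ((Q : ℂ) + z) + 1 + 1 := by
    apply Complex.ext
    · simp only [sub_re, add_re, ofReal_re, one_re, hz, conj_re]
      ring
    · simp only [sub_im, add_im, ofReal_im, one_im, conj_im]
      ring
  have hre : -1 < ((Q : ℂ) + z).re := by
    simp only [add_re, ofReal_re, hz]
    linarith
  rw [hnum, norm_Gamma_conj_add_two_div hre]

/-- On `σ = ½`: `|f(½ + it)| = 1`. [folklore] -/
private lemma norm_quot'_right {Q : ℝ} (hQ : 0 ≤ Q) {z : ℂ} (hz : z.re = 1 / 2) :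
    ‖Gamma (Q + 1 - z) / Gamma (Q + z)‖ = 1 := by
  have hnum : (Q : ℂ) + 1 - z = conj ((Q : ℂ) + z) := by
    apply Complex.ext
    · simp only [sub_re, add_re, ofReal_re, one_re, hz, conj_re]
      ring
    · simp only [sub_im, add_im, ofReal_im, one_im, conj_im]
      ring
  have hre : 0 < ((Q : ℂ) + z).re := by
    simp only [add_re, ofReal_re, hz]
    linarith
  rw [hnum, norm_Gamma_conj_div hre]

/-- `f` is regular for `σ < Q + 1`. [folklore] -/
private lemma differentiableAt_quot' {Q : ℝ} {z : ℂ} (hz : z.re < Q + 1) :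
    DifferentiableAt ℂ (fun z : ℂ ↦ Gamma (Q + 1 - z) / Gamma (Q + z)) z := by
  have hfun : (fun z : ℂ ↦ Gamma (Q + 1 - z) / Gamma (Q + z)) =
      fun z : ℂ ↦ Gamma (Q + 1 - z) * (Gamma (Q + z))⁻¹ :=
    funext fun z ↦ div_eq_mul_inv _ _
  rw [hfun]
  refine DifferentiableAt.mul ?_ ?_
  · refine (Complex.differentiableAt_Gamma _ fun m hm ↦ ?_).comp z
      ((differentiableAt_const _).sub differentiableAt_id)
    have hre := congrArg re hm
    simp only [sub_re, add_re, ofReal_re, one_re, neg_re, natCast_re] at hre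
    have : (0 : ℝ) ≤ m := Nat.cast_nonneg m
    linarith
  · exact Complex.differentiable_one_div_Gamma.differentiableAt.comp z
      ((differentiableAt_const _).add differentiableAt_id)

/-- `f` is regular on the closed strip `−½ ≤ σ ≤ ½`. [folklore] -/
private lemma diffContOnCl_quot' {Q : ℝ} (hQ : 0 ≤ Q) :
    DiffContOnCl ℂ (fun z : ℂ ↦ Gamma (Q + 1 - z) / Gamma (Q + z))
      (re ⁻¹' Ioo (-1 / 2 : ℝ) (1 / 2)) := by
  refine DifferentiableOn.diffContOnCl fun z hz ↦ ?_
  rw [closure_preimage_re, closure_Ioo (by norm_num), mem_preimage, mem_Icc] at hz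
  exact (differentiableAt_quot' (by linarith [hz.2])).differentiableWithinAt

/-- `f` is of finite order in the open strip (crudely: `|f| ≤ K exp(L e^{|t|})`). [folklore] -/
private lemma growth_quot' {Q : ℝ} (hQ : 0 ≤ Q) :
    ∃ c < π / ((1 / 2 : ℝ) - -1 / 2), ∃ K L : ℝ, ∀ z : ℂ, -1 / 2 < z.re → z.re < 1 / 2 →
      ‖(fun z : ℂ ↦ Gamma (Q + 1 - z) / Gamma (Q + z)) z‖ ≤
        K * Real.exp (L * Real.exp (c * |z.im|)) := by
  obtain ⟨M, hM0, hM⟩ := exists_Gamma_le (lo := Q + 1 / 2) (hi := Q + 3 / 2) (by linarith)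
  obtain ⟨A, c, hA, hc, hAc⟩ :=
    NumberField.exists_norm_inv_Gamma_le_of_abs_re_le (S := Q + 1 / 2) (by linarith)
  refine ⟨1, ?_, M * (A * Real.exp (c * (Q + 1 / 2) ^ 2)), 4 * c, fun z h1 h2 ↦ ?_⟩
  · have : π / ((1 / 2 : ℝ) - -1 / 2) = π := by norm_num
    rw [this]; linarith [Real.pi_gt_three]
  simp only [one_mul]
  rw [norm_div, div_eq_mul_inv, ← norm_inv]
  have hre1 : ((Q : ℂ) + 1 - z).re = Q + 1 - z.re := by
    simp only [sub_re, add_re, ofReal_re, one_re]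
  have hre2 : ((Q : ℂ) + z).re = Q + z.re := by simp only [add_re, ofReal_re]
  have him2 : ((Q : ℂ) + z).im = z.im := by simp only [add_im, ofReal_im, zero_add]
  have hnum : ‖Gamma ((Q : ℂ) + 1 - z)‖ ≤ M := by
    refine (norm_Gamma_le_Gamma_re (by rw [hre1]; linarith)).trans (hM _ ⟨?_, ?_⟩)
    · rw [hre1]; linarith
    · rw [hre1]; linarith
  have hden : ‖(Gamma ((Q : ℂ) + z))⁻¹‖ ≤
      A * Real.exp (c * (Q + 1 / 2) ^ 2) * Real.exp (4 * c * Real.exp |z.im|) := by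
    have hre : |((Q : ℂ) + z).re| ≤ Q + 1 / 2 := by
      rw [hre2, abs_le]; constructor <;> linarith
    refine (hAc _ hre).trans ?_
    rw [mul_assoc, ← Real.exp_add]
    gcongr
    have hsq : ‖(Q : ℂ) + z‖ ^ 2 ≤ (Q + 1 / 2) ^ 2 + 4 * Real.exp |z.im| := by
      rw [norm_sq_eq, hre2, him2]
      have ha' : (Q + z.re) ^ 2 ≤ (Q + 1 / 2) ^ 2 := sq_le_sq' (by linarith) (by linarith)
      have hb' := sq_le_four_mul_exp_abs z.im
      linarith
    calc c * ‖(Q : ℂ) + z‖ ^ 2 ≤ c * ((Q + 1 / 2) ^ 2 + 4 * Real.exp |z.im|) := by gcongr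
      _ = c * (Q + 1 / 2) ^ 2 + 4 * c * Real.exp |z.im| := by ring
  calc ‖Gamma ((Q : ℂ) + 1 - z)‖ * ‖(Gamma ((Q : ℂ) + z))⁻¹‖
      ≤ M * (A * Real.exp (c * (Q + 1 / 2) ^ 2) * Real.exp (4 * c * Real.exp |z.im|)) :=
        mul_le_mul hnum hden (norm_nonneg _) hM0
    _ = M * (A * Real.exp (c * (Q + 1 / 2) ^ 2)) * Real.exp (4 * c * Real.exp |z.im|) := by ring

/-- **Rademacher 1959, Lemma 3, (5.4):** "For `Q ≥ 0`, `−½ ≤ σ ≤ ½` we have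
`|Γ(Q + 1 − s) / Γ(Q + s)| ≤ |Q + 1 + s|^{1−2σ}`.  Remark. Equality holds here on the boundaries
under the same circumstances as in Lemma 1."  Proof as printed: `a = −½`, `b = ½`,
`|f(a+it)| = |Q + ½ + it| · |Q − ½ + it| ≤ |Q + ½ + it|² = |Q + 1 + a + it|²`, `|f(b+it)| = 1`;
"Theorem 2 with `α = 2`, `β = 0` and `Q + 1` instead of `Q` yields immediately (5.4)."
[cite: Rademacher1959, §5 Lemma 3 (5.4)] -/
theorem norm_Gamma_quot_le' {Q : ℝ} (hQ : 0 ≤ Q) {s : ℂ} (h₁ : -1 / 2 ≤ s.re)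
    (h₂ : s.re ≤ 1 / 2) :
    ‖Gamma (Q + 1 - s) / Gamma (Q + s)‖ ≤ ‖(Q : ℂ) + 1 + s‖ ^ (1 - 2 * s.re) := by
  have ha : ∀ z : ℂ, z.re = -1 / 2 →
      ‖(fun z : ℂ ↦ Gamma (Q + 1 - z) / Gamma (Q + z)) z‖ ≤
        1 * ‖((Q + 1 : ℝ) : ℂ) + z‖ ^ (2 : ℝ) := by
    intro z hz
    simp only
    rw [one_mul, Real.rpow_two, norm_quot'_left hQ hz]
    have e : ((Q + 1 : ℝ) : ℂ) + z = (Q : ℂ) + z + 1 := by push_cast; ring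
    rw [e, sq]
    have hle : ‖(Q : ℂ) + z‖ ≤ ‖(Q : ℂ) + z + 1‖ := by
      apply norm_le_norm_of_sq_le
      simp only [add_re, ofReal_re, hz, one_re, add_im, ofReal_im, one_im, zero_add, add_zero]
      nlinarith
    exact mul_le_mul_of_nonneg_left hle (norm_nonneg _)
  have hb : ∀ z : ℂ, z.re = 1 / 2 →
      ‖(fun z : ℂ ↦ Gamma (Q + 1 - z) / Gamma (Q + z)) z‖ ≤
        1 * ‖((Q + 1 : ℝ) : ℂ) + z‖ ^ (0 : ℝ) := by
    intro z hz
    simp only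
    rw [Real.rpow_zero, mul_one, norm_quot'_right hQ hz]
  have key := Literature.Analysis.Complex.Rademacher.norm_le_interpolate
    (f := fun z : ℂ ↦ Gamma (Q + 1 - z) / Gamma (Q + z))
    (show (-1 / 2 : ℝ) < 1 / 2 by norm_num) (show (0 : ℝ) < Q + 1 + -1 / 2 by linarith)
    one_pos one_pos (show (0 : ℝ) ≤ 2 by norm_num) (diffContOnCl_quot' hQ)
    (growth_quot' hQ) ha hb h₁ h₂
  simp only [Real.rpow_zero, mul_one, Real.one_rpow, one_mul] at key
  have e3 : ((Q + 1 : ℝ) : ℂ) + s = (Q : ℂ) + 1 + s := by push_cast; ring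
  rw [e3, ← Real.rpow_mul (norm_nonneg _)] at key
  convert key using 2
  field_simp
  ring

/-! ### §6: Dirichlet `L`-functions -/

variable {q : ℕ} [NeZero q]

/-- The Archimedean factor of `χ` is `Γ_ℝ(s + a)`, `a = charParity χ`. [folklore] -/
private lemma gammaFactor_eq (χ : DirichletCharacter ℂ q) (s : ℂ) :
    gammaFactor χ s = Gammaℝ (s + charParity χ) := by
  rcases χ.even_or_odd with h | h
  · rw [h.gammaFactor_def, charParity_of_even h, Nat.cast_zero, add_zero]
  · rw [h.gammaFactor_def, charParity_of_odd h, Nat.cast_one]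

/-- **The functional equation in modulus** (Rademacher 1959, §6, the display after (6.1)): for a
primitive `χ` modulo `k > 1` with `χ(−1) = (−1)^a` (`a = charParity χ ∈ {0, 1}`),
`|L(s, χ)| = (π/k)^{σ−½} · |Γ(a/2 + (1−s)/2) / Γ(a/2 + s/2)| · |L(1 − s, χ̄)|`, from
`(π/k)^{−s/2} Γ((a+s)/2) L(s, χ) = ε(χ) (π/k)^{−(1−s)/2} Γ((a+1−s)/2) L(1−s, χ̄)`, `|ε(χ)| = 1`.
Stated for `σ < 1` (for `σ ≥ 1` the right-hand `Γ`-quotient meets the poles of its numerator).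
[cite: Rademacher1959, §6 (display before (6.2))] -/
theorem norm_LFunction_eq_reflect (hq : 1 < q) {χ : DirichletCharacter ℂ q} (hχ : χ.IsPrimitive)
    {s : ℂ} (hs : s.re < 1) :
    ‖χ.LFunction s‖ = (π / q) ^ (s.re - 1 / 2) *
      ‖Gamma ((charParity χ : ℂ) / 2 + (1 - s) / 2) / Gamma ((charParity χ : ℂ) / 2 + s / 2)‖ *
        ‖χ⁻¹.LFunction (1 - s)‖ := by
  have hq1 : q ≠ 1 := by omega
  have hqpos : 0 < q := by omega
  have hqR : (0 : ℝ) < q := by exact_mod_cast hqpos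
  set κ : ℕ := charParity χ with hκdef
  set w : ℂ := 1 - s with hw
  have hwre : w.re = 1 - s.re := by simp [hw]
  have hw0 : 0 < w.re := by rw [hwre]; linarith
  -- the representation through the functional equation
  have hL : LFunction χ s = completedLFunction χ s / gammaFactor χ s :=
    LFunction_eq_completed_div_gammaFactor χ s (Or.inr hq1)
  have hFE : completedLFunction χ s = q ^ (w - 1 / 2) * rootNumber χ * completedLFunction χ⁻¹ w := by
    have := hχ.completedLFunction_one_sub w
    rwa [show 1 - w = s by simp [hw]] at this
  have hΛw : completedLFunction χ⁻¹ w = gammaFactor χ w * LFunction χ⁻¹ w := by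
    rw [LFunction_eq_completed_div_gammaFactor χ⁻¹ w (Or.inr hq1), SelbergDirichlet.gammaFactor_inv]
    field_simp [SelbergDirichlet.gammaFactor_ne_zero_of_re_pos χ hw0]
  set z : ℂ := (s + κ) / 2 with hzdef
  have hπ0 : (π : ℂ) ≠ 0 := ofReal_ne_zero.mpr Real.pi_ne_zero
  have hrepr : LFunction χ s = (q : ℂ) ^ (w - 1 / 2) * rootNumber χ *
      ((π : ℂ) ^ (-(w + κ) / 2) * Gamma ((w + κ) / 2)) * LFunction χ⁻¹ w *
        (π : ℂ) ^ ((s + κ) / 2) * (Gamma z)⁻¹ := by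
    rw [hL, hFE, hΛw, gammaFactor_eq, gammaFactor_eq, Gammaℝ_def, Gammaℝ_def, div_eq_mul_inv,
      mul_inv, show (-(s + ↑κ) / 2) = -((s + κ) / 2) by ring, cpow_neg, inv_inv]
    ring
  -- the quotient of the statement is `Γ((w+κ)/2) (Γ z)⁻¹`
  have e1 : (κ : ℂ) / 2 + (1 - s) / 2 = (w + κ) / 2 := by rw [hw]; ring
  have e2 : (κ : ℂ) / 2 + s / 2 = z := by rw [hzdef]; ring
  rw [e1, e2, hrepr]
  simp only [norm_mul, norm_inv, norm_div]
  rw [norm_natCast_cpow_of_pos hqpos, SelbergDirichlet.norm_rootNumber hχ,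
    Complex.norm_cpow_eq_rpow_re_of_pos Real.pi_pos, Complex.norm_cpow_eq_rpow_re_of_pos Real.pi_pos]
  have hr1 : (w - 1 / 2).re = 1 / 2 - s.re := by
    simp only [sub_re, hwre, div_ofNat_re, one_re]; ring
  have hr2 : (-(w + (κ : ℂ)) / 2).re = -(1 - s.re + κ) / 2 := by
    simp only [div_ofNat_re, neg_re, add_re, hwre, natCast_re]
  have hr3 : ((s + (κ : ℂ)) / 2).re = (s.re + κ) / 2 := by
    simp only [div_ofNat_re, add_re, natCast_re]
  rw [hr1, hr2, hr3]
  -- `q^{1/2-σ} π^{-(1-σ+κ)/2} π^{(σ+κ)/2} = (π/q)^{σ-1/2}`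
  have hππ : π ^ (-(1 - s.re + κ) / 2) * π ^ ((s.re + κ) / 2) = π ^ (s.re - 1 / 2) := by
    rw [← Real.rpow_add Real.pi_pos]; congr 1; ring
  have hqq : (q : ℝ) ^ (1 / 2 - s.re) = (q : ℝ) ^ (-(s.re - 1 / 2)) := by congr 1; ring
  rw [Real.div_rpow Real.pi_pos.le hqR.le, hqq, Real.rpow_neg hqR.le, ← hππ]
  ring

/-- **Rademacher 1959, §6** (the display before (6.2)): for a primitive `χ` modulo `k > 1` and
`−½ ≤ σ ≤ ½`, `|L(s, χ)| ≤ (2π/k)^{σ−½} |1 + s|^{½−σ} |L(1 − s, χ̄)|` — "we apply on the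
`Γ`-quotient Lemma 1 or 2 according to the values `0` or `1` of `a`."
[cite: Rademacher1959, §6 (display before (6.2))] -/
theorem norm_LFunction_le_reflect (hq : 1 < q) {χ : DirichletCharacter ℂ q} (hχ : χ.IsPrimitive)
    {s : ℂ} (h₁ : -1 / 2 ≤ s.re) (h₂ : s.re ≤ 1 / 2) :
    ‖χ.LFunction s‖ ≤ (2 * π / q) ^ (s.re - 1 / 2) * ‖1 + s‖ ^ (1 / 2 - s.re) *
      ‖χ⁻¹.LFunction (1 - s)‖ := by
  have hqpos : 0 < q := by omega
  have hqR : (0 : ℝ) < q := by exact_mod_cast hqpos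
  rw [norm_LFunction_eq_reflect hq hχ (by linarith)]
  -- Lemma 1 (`a = 0`, `Q = 0`) or Lemma 2 (`a = 1`, `Q = 1`): both give `(½|1+s|)^{½-σ}`
  have hΓ : ‖Gamma ((charParity χ : ℂ) / 2 + (1 - s) / 2) /
      Gamma ((charParity χ : ℂ) / 2 + s / 2)‖ ≤ (‖1 + s‖ / 2) ^ (1 / 2 - s.re) := by
    rcases χ.even_or_odd with he | ho
    · have h := norm_Gamma_quot_le (Q := 0) le_rfl h₁ h₂
      rw [charParity_of_even he, Nat.cast_zero]
      simpa using h
    · have h := norm_Gamma_quot_le_sharp (Q := 1) (by norm_num) h₁ h₂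
      rw [charParity_of_odd ho, Nat.cast_one]
      simpa using h
  have hπq : 0 < π / q := div_pos Real.pi_pos hqR
  calc (π / q) ^ (s.re - 1 / 2) *
        ‖Gamma ((charParity χ : ℂ) / 2 + (1 - s) / 2) / Gamma ((charParity χ : ℂ) / 2 + s / 2)‖ *
          ‖χ⁻¹.LFunction (1 - s)‖
      ≤ (π / q) ^ (s.re - 1 / 2) * (‖1 + s‖ / 2) ^ (1 / 2 - s.re) * ‖χ⁻¹.LFunction (1 - s)‖ := by
        gcongr
    _ = (2 * π / q) ^ (s.re - 1 / 2) * ‖1 + s‖ ^ (1 / 2 - s.re) * ‖χ⁻¹.LFunction (1 - s)‖ := by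
        rw [Real.div_rpow (norm_nonneg _) zero_le_two, show (2 * π / q : ℝ) = 2 * (π / q) by ring,
          Real.mul_rpow zero_le_two hπq.le,
          show (1 / 2 - s.re : ℝ) = -(s.re - 1 / 2) by ring, Real.rpow_neg zero_le_two,
          Real.rpow_neg (norm_nonneg _)]
        have h2 : (2 : ℝ) ^ (s.re - 1 / 2) ≠ 0 := (Real.rpow_pos_of_pos two_pos _).ne'
        field_simp

/-- **Rademacher 1959, (6.2):** for a primitive `χ` modulo `k > 1`, `0 < η ≤ ½` and `s = −η + it`,
`|L(−η + it, χ)| ≤ (k/2π)^{η+½} |1 + s|^{η+½} ζ(1 + η)` (from the previous display and (6.1)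
`|L(1 + η − it, χ̄)| ≤ ζ(1 + η)`). [cite: Rademacher1959, §6 (6.2)] -/
theorem norm_LFunction_le_of_re_eq_neg (hq : 1 < q) {χ : DirichletCharacter ℂ q}
    (hχ : χ.IsPrimitive) {η : ℝ} (hη₀ : 0 < η) (hη : η ≤ 1 / 2) {s : ℂ} (hs : s.re = -η) :
    ‖χ.LFunction s‖ ≤
      (q / (2 * π)) ^ (η + 1 / 2) * ‖1 + s‖ ^ (η + 1 / 2) * (riemannZeta (1 + η)).re := by
  have hqpos : 0 < q := by omega
  have hqR : (0 : ℝ) < q := by exact_mod_cast hqpos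
  have h2πq : 0 < 2 * π / q := div_pos (by positivity) hqR
  refine (norm_LFunction_le_reflect hq hχ (by linarith) (by linarith)).trans ?_
  -- (6.1) for `χ̄` at `1 - s = (1 + η) + (-t) i`
  have h61 : ‖χ⁻¹.LFunction (1 - s)‖ ≤ (riemannZeta (1 + η)).re := by
    have e : (1 : ℂ) - s = ((1 + η : ℝ) : ℂ) + ((-s.im : ℝ) : ℂ) * I :=
      Complex.ext (by simp [hs]) (by simp)
    have h := Booker2006Turing.norm_LFunction_le_bigZ χ⁻¹ (σ := 1 + η) (by linarith) (-s.im)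
    rw [← e, Booker2006Turing.bigZ] at h
    simpa using h
  have hexp1 : (s.re - 1 / 2 : ℝ) = -(η + 1 / 2) := by rw [hs]; ring
  have hexp2 : (1 / 2 - s.re : ℝ) = η + 1 / 2 := by rw [hs]; ring
  rw [hexp1, hexp2, Real.rpow_neg h2πq.le, ← Real.inv_rpow h2πq.le, inv_div]
  gcongr

/-- `L(s, χ)` is of finite order in every vertical strip `|σ| ≤ 3/2` (crudely:
`|L| ≤ K exp(L e^{|t|})`), from `SelbergDirichlet.norm_LFunction_le_exp`. [folklore] -/
private lemma growth_LFunction (hq : 1 < q) {χ : DirichletCharacter ℂ q} (hχ : χ.IsPrimitive)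
    {a b : ℝ} (ha : -3 / 2 ≤ a) (hb : b ≤ 3 / 2) (hab : b - a ≤ 2) (hab' : a < b) :
    ∃ c < π / (b - a), ∃ K L : ℝ, ∀ z : ℂ, a < z.re → z.re < b →
      ‖χ.LFunction z‖ ≤ K * Real.exp (L * Real.exp (c * |z.im|)) := by
  have hq1 : q ≠ 1 := by omega
  set Z : ℝ := ∑' n : ℕ, ((n + 1 : ℕ) : ℝ) ^ (-(1 / 2 : ℝ) - 1)
  refine ⟨1, ?_, 25 * q * Z, (q + 7) * 15, fun z h1 h2 ↦ ?_⟩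
  · rw [lt_div_iff₀ (by linarith)]
    nlinarith [Real.pi_gt_three]
  refine (SelbergDirichlet.norm_LFunction_le_exp hχ hq1 z).trans ?_
  rw [one_mul]
  have hZ : 0 ≤ 25 * (q : ℝ) * Z := by positivity
  refine mul_le_mul_of_nonneg_left (Real.exp_le_exp.mpr ?_) hZ
  rw [mul_assoc]
  refine mul_le_mul_of_nonneg_left ?_ (by positivity)
  -- `(1 + ‖z‖)² ≤ 2 + 2‖z‖² ≤ 2 + 2(9/4 + t²) ≤ 15 e^{|t|}`
  have hn2 : ‖z‖ ^ 2 ≤ 9 / 4 + z.im ^ 2 := by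
    rw [norm_sq_eq]
    have : z.re ^ 2 ≤ (3 / 2 : ℝ) ^ 2 := sq_le_sq' (by linarith) (by linarith)
    linarith
  have h1e : 1 ≤ Real.exp |z.im| := Real.one_le_exp (abs_nonneg _)
  have ht := sq_le_four_mul_exp_abs z.im
  nlinarith [norm_nonneg z]

/-- **Rademacher 1959, Theorem 3** (p. 199): "For `−½ ≤ −η ≤ σ ≤ 1 + η ≤ 3/2`, for all moduli
`k > 1` and all primitive characters `χ` modulo `k` the inequality
`|L(s, χ)| ≤ (k|1 + s|/2π)^{(1+η−σ)/2} ζ(1 + η)` holds."  (Here `0 < η ≤ ½`; `ζ(1+η)` is the real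
number `(riemannZeta (1+η)).re`.)  Quoted as Lemma 4 of Rumely 1993 (p. 430: "See [19, Theorem 3,
p. 199]") and as (3.5)–(3.6) of Trudgian 2011.  Proof as printed: "From (6.1) and (6.2) we derive
then through Theorem 2 the result" — `Rademacher.norm_le_interpolate` on `S(−η, 1+η)` with `Q = 1`,
`A = (k/2π)^{½+η} ζ(1+η)`, `α = ½ + η`, `B = ζ(1+η)`, `β = 0`.
[cite: Rademacher1959, §6 Theorem 3, p. 199] [cite: Rumely1993ERH, Lemma 4, p. 430] -/
theorem norm_LFunction_le (hq : 1 < q) {χ : DirichletCharacter ℂ q} (hχ : χ.IsPrimitive) {η : ℝ}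
    (hη₀ : 0 < η) (hη : η ≤ 1 / 2) {s : ℂ} (h₁ : -η ≤ s.re) (h₂ : s.re ≤ 1 + η) :
    ‖χ.LFunction s‖ ≤
      (q * ‖1 + s‖ / (2 * π)) ^ ((1 + η - s.re) / 2) * (riemannZeta (1 + η)).re := by
  have hq1 : q ≠ 1 := by omega
  have hqpos : 0 < q := by omega
  have hqR : (0 : ℝ) < q := by exact_mod_cast hqpos
  have hχ1 : χ ≠ 1 := SelbergDirichlet.ne_one_of_isPrimitive hq1 hχ
  set ζ : ℝ := (riemannZeta (1 + η)).re with hζdef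
  have hζ : 0 < ζ := by
    have h := Booker2006Turing.bigZ_pos (σ := 1 + η) (by linarith)
    rw [Booker2006Turing.bigZ] at h
    simpa using h
  set A : ℝ := (q / (2 * π)) ^ (1 / 2 + η) * ζ with hAdef
  have hq2π : 0 < (q : ℝ) / (2 * π) := div_pos hqR (by positivity)
  have hA : 0 < A := mul_pos (Real.rpow_pos_of_pos hq2π _) hζ
  -- (6.2) on `σ = -η`
  have ha : ∀ z : ℂ, z.re = -η → ‖χ.LFunction z‖ ≤ A * ‖((1 : ℝ) : ℂ) + z‖ ^ (1 / 2 + η) := by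
    intro z hz
    rw [ofReal_one]
    calc ‖χ.LFunction z‖ ≤ (q / (2 * π)) ^ (η + 1 / 2) * ‖1 + z‖ ^ (η + 1 / 2) * ζ :=
          norm_LFunction_le_of_re_eq_neg hq hχ hη₀ hη hz
      _ = A * ‖1 + z‖ ^ (1 / 2 + η) := by rw [hAdef, add_comm η (1 / 2)]; ring
  -- (6.1) on `σ = 1 + η`
  have hb : ∀ z : ℂ, z.re = 1 + η → ‖χ.LFunction z‖ ≤ ζ * ‖((1 : ℝ) : ℂ) + z‖ ^ (0 : ℝ) := by
    intro z hz
    rw [Real.rpow_zero, mul_one]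
    have e : z = ((1 + η : ℝ) : ℂ) + ((z.im : ℝ) : ℂ) * I := Complex.ext (by simp [hz]) (by simp)
    have h := Booker2006Turing.norm_LFunction_le_bigZ χ (σ := 1 + η) (by linarith) z.im
    rw [← e, Booker2006Turing.bigZ] at h
    simpa using h
  have hab : (-η : ℝ) < 1 + η := by linarith
  have key := Literature.Analysis.Complex.Rademacher.norm_le_interpolate (f := χ.LFunction) (Q := 1) hab (by linarith) hA hζ
    (show (0 : ℝ) ≤ 1 / 2 + η by linarith) (differentiable_LFunction hχ1).diffContOnCl
    (growth_LFunction hq hχ (by linarith) (by linarith) (by linarith) hab) ha hb h₁ h₂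
  simp only [Real.rpow_zero, mul_one, ofReal_one] at key
  refine key.trans (le_of_eq ?_)
  -- the algebra `(A|1+s|^α)^p ζ^{1-p} = (k|1+s|/2π)^{(1+η-σ)/2} ζ`
  have hden : (0 : ℝ) < 1 + η - -η := by linarith
  set p : ℝ := (1 + η - s.re) / (1 + η - -η) with hp
  set p' : ℝ := (s.re - -η) / (1 + η - -η) with hp'
  have hp0 : 0 ≤ p := div_nonneg (by linarith) hden.le
  have hp'0 : 0 ≤ p' := div_nonneg (by linarith) hden.le
  have hpp' : p + p' = 1 := by rw [hp, hp']; field_simp; ring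
  have hn0 : 0 ≤ ‖(1 : ℂ) + s‖ := norm_nonneg _
  have hAn : A * ‖(1 : ℂ) + s‖ ^ (1 / 2 + η) = (q * ‖(1 : ℂ) + s‖ / (2 * π)) ^ (1 / 2 + η) * ζ := by
    rw [hAdef, show (q * ‖(1 : ℂ) + s‖ / (2 * π) : ℝ) = q / (2 * π) * ‖(1 : ℂ) + s‖ by ring,
      Real.mul_rpow hq2π.le hn0]
    ring
  have hbase : 0 ≤ (q * ‖(1 : ℂ) + s‖ / (2 * π) : ℝ) := by positivity
  rw [hAn, Real.mul_rpow (Real.rpow_nonneg hbase _) hζ.le, ← Real.rpow_mul hbase, mul_assoc,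
    ← Real.rpow_add hζ, hpp', Real.rpow_one]
  congr 2
  rw [hp]; field_simp; ring

/-- Theorem 3 with `ζ(1+η)` written as `‖ζ(1+η)‖` (`= Booker2006Turing.bigZ (1+η)`).
[cite: Rademacher1959, §6 Theorem 3, p. 199] -/
theorem norm_LFunction_le_norm_zeta (hq : 1 < q) {χ : DirichletCharacter ℂ q} (hχ : χ.IsPrimitive)
    {η : ℝ} (hη₀ : 0 < η) (hη : η ≤ 1 / 2) {s : ℂ} (h₁ : -η ≤ s.re) (h₂ : s.re ≤ 1 + η) :
    ‖χ.LFunction s‖ ≤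
      (q * ‖1 + s‖ / (2 * π)) ^ ((1 + η - s.re) / 2) * ‖riemannZeta (1 + η)‖ := by
  have h := norm_LFunction_le hq hχ hη₀ hη h₁ h₂
  have e : (riemannZeta (1 + η)).re = ‖riemannZeta (1 + η)‖ := by
    have h' := Booker2006Turing.bigZ_eq_norm (σ := 1 + η) (by linarith)
    rw [Booker2006Turing.bigZ] at h'
    simpa using h'
  rwa [e] at h

/-- Theorem 3 in logarithmic form, the shape in which it is consumed (Rumely 1993, (10) p. 430,
with `η = 0.25`: "`ln|L(s, χ)| ≤ (5/8 − σ/2)·[ln(Q|1+s|/(2π))] + ln(ζ(1.25))`"): for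
`L(s, χ) ≠ 0`, `log|L(s, χ)| ≤ ((1+η−σ)/2) log(k|1+s|/2π) + log ζ(1+η)`.
[cite: Rademacher1959, §6 Theorem 3, p. 199] [cite: Rumely1993ERH, (10) p. 430] -/
theorem log_norm_LFunction_le (hq : 1 < q) {χ : DirichletCharacter ℂ q} (hχ : χ.IsPrimitive)
    {η : ℝ} (hη₀ : 0 < η) (hη : η ≤ 1 / 2) {s : ℂ} (h₁ : -η ≤ s.re) (h₂ : s.re ≤ 1 + η)
    (hL : χ.LFunction s ≠ 0) :
    Real.log ‖χ.LFunction s‖ ≤ (1 + η - s.re) / 2 * Real.log (q * ‖1 + s‖ / (2 * π)) +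
      Real.log (riemannZeta (1 + η)).re := by
  have hqR : (0 : ℝ) < q := by exact_mod_cast (show 0 < q by omega)
  have hζ : 0 < (riemannZeta (1 + η)).re := by
    have h := Booker2006Turing.bigZ_pos (σ := 1 + η) (by linarith)
    rw [Booker2006Turing.bigZ] at h
    simpa using h
  have h1s : 0 < ‖(1 : ℂ) + s‖ := by
    refine norm_pos_iff.mpr fun h0 ↦ ?_
    have := congrArg re h0
    rw [add_re, one_re, zero_re] at this
    linarith
  have hb : 0 < (q : ℝ) * ‖(1 : ℂ) + s‖ / (2 * π) := by positivity
  have h := norm_LFunction_le hq hχ hη₀ hη h₁ h₂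
  calc Real.log ‖χ.LFunction s‖
      ≤ Real.log ((q * ‖1 + s‖ / (2 * π)) ^ ((1 + η - s.re) / 2) * (riemannZeta (1 + η)).re) :=
        Real.log_le_log (norm_pos_iff.mpr hL) h
    _ = (1 + η - s.re) / 2 * Real.log (q * ‖1 + s‖ / (2 * π)) +
          Real.log (riemannZeta (1 + η)).re := by
        rw [Real.log_mul (Real.rpow_pos_of_pos hb _).ne' hζ.ne', Real.log_rpow hb]

end Rademacher1959

end Literature.NumberTheory.LFunctions
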